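import Summits.KontsevichZagierPeriods.KontsevichZagierPeriods.Theses.IsogenyCertificates
import Summits.KontsevichZagierPeriods.KontsevichZagierPeriods.Theorems.IsogenyCertificatesXMapKernelCellsUnconditional
import Summits.KontsevichZagierPeriods.KontsevichZagierPeriods.Theorems.IsogenyCertificatesBiellipticRealPeriodCellStubHalfMoves
import Summits.KontsevichZagierPeriods.KontsevichZagierPeriods.Theorems.IsogenyCertificatesBiellipticRealPeriodCellStubAssemblySa
import Literature.NumberTheory.Transcendental.KZCalculus

/-!
# `BiellipticRealPeriodCell` (stmt-KontsevichZagierPeriods-18685, route IsogenyCertificates) — PROVED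
(line `Sketch` = idea `sextic-xmap-data-pushforward`; lead prover 0, 2026-08-17)

The crux: Conjecture 1 of Kontsevich–Zagier in kernel form on the BIELLIPTIC sector — every value-`0`
formal `ℤ`-combination of representations `[K, (a₀ + a₁x)/√G(x²)]` (`G ∈ ℚ[u]` cubic, `F = G(x²)`
squarefree, `K` a BOUNDED connected component of `{F > 0}`, `a₀, a₁ ∈ ℚ`: complete real half-periods of
`dx/y`, `x dx/y` over a real oval of the genus-2 curve `y² = F(x)`, whose Jacobian is (2,2)-isogenous to
the product of the elliptic quotients `E₁ : y² = G(u)`, `E₂ : w² = u³G(1/u)`) lies in `KZ.relations`.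

Proof (the skeleton `Cruxes/BiellipticRealPeriodCell/Lines/Sketch.lean` with every stub landed):

* `kernel_transfer` (here): kernel form passes from a sector `T` to a sector `S` as soon as every
  generator of `S` is congruent modulo `KZ.relations` to an element of `closure T` (closure induction +
  soundness `KZ.relations_le_ker_eval_holds`).
* The generatorwise transfer of the bielliptic sector into the real-period cell (i)
  (`Assembly.stub_assembly_of_halfMovesSa`, fed with the two rule-(2) moves `HalfMoves.stub_halfMoves`):
  shape of a bounded component `K = (α, β)` (`ComponentShape`), convergence of `dx/√F` on it
  (`InvSqrtIntegrable`), integral short-Weierstrass models of the two elliptic quotients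
  (`IntegralModels`), split at `0` / into odd and even parts (rules 1a, 1b), one change of variables per
  part and sign-half along `(x² − s₁)/m₁` resp. `(x⁻² − s₂)/m₂` (`HalfMoves`, an instance of the landed
  one-sheet transport), identification of the images (`Images`), formal cancellation of the two odd targets
  of a central oval, and landing of whole-component representations of integral cubics in the span of the
  cell-(i) generators (`ComponentLanding`: `stub_cubicComponents`, `stub_unboundedToEgg`).
* The LANDED real-period cell (i), `XMapKernelCells.realPeriodCellKernel_relations` (all `ℚ`-linear
  relations among real periods of elliptic curves over `ℚ` are KZ move chains; transcendence input =
  the tree's theorem `HuberWustholzManyCurvePeriods_holds`).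

No hypothesis, no named fact: the result is unconditional. No definitions are introduced.

References: M. Kontsevich, D. Zagier, *Periods* (2001), §1.2; T. Shaska, H. Völklein, *Elliptic
subfields and automorphisms of genus 2 function fields* (2001), §2 (the two elliptic quotients);
A. Huber, G. Wüstholz, *Transcendence and linear relations of 1-periods* (2022), Thm. 15.3.
-/

noncomputable section

namespace Summit.KontsevichZagierPeriods.IsogenyCertificates.BiellipticRealPeriodCellLine

open Literature.NumberTheory.Transcendental
open Summit.KontsevichZagierPeriods.KontsevichZagierPeriods.Theses.IsogenyCertificates

/-- **Kernel transfer between sectors.** If every generator of `S` is congruent modulo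
`KZ.relations` to an element of `closure T`, and the kernel form holds on `closure T`, then the
kernel form holds on `closure S`: for `c ∈ closure S` pick `e ∈ closure T` with `c − e ∈ relations`
(closure induction); `eval (c − e) = 0` by soundness (`KZ.relations_le_ker_eval_holds`), so
`eval c = 0` forces `eval e = 0`, `e ∈ relations`, and `c = (c − e) + e ∈ relations`.
[cite: KontsevichZagier2001, §1.2] -/
theorem kernel_transfer {S T : Set KZ.FormalRep}
    (hST : ∀ d ∈ S, ∃ e ∈ AddSubgroup.closure T, d - e ∈ KZ.relations)
    (hT : ∀ c ∈ AddSubgroup.closure T, KZ.eval c = 0 → c ∈ KZ.relations) :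
    ∀ c ∈ AddSubgroup.closure S, KZ.eval c = 0 → c ∈ KZ.relations := by
  intro c hc
  have key : ∃ e ∈ AddSubgroup.closure T, c - e ∈ KZ.relations := by
    induction hc using AddSubgroup.closure_induction with
    | mem x hx => exact hST x hx
    | zero => exact ⟨0, AddSubgroup.zero_mem _, by simp [KZ.relations.zero_mem]⟩
    | add x y _ _ hx hy =>
        obtain ⟨e, he, hxe⟩ := hx
        obtain ⟨f, hf, hyf⟩ := hy
        refine ⟨e + f, AddSubgroup.add_mem _ he hf, ?_⟩
        have : x + y - (e + f) = (x - e) + (y - f) := by abel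
        rw [this]
        exact KZ.relations.add_mem hxe hyf
    | neg x _ hx =>
        obtain ⟨e, he, hxe⟩ := hx
        refine ⟨-e, AddSubgroup.neg_mem _ he, ?_⟩
        have : -x - -e = -(x - e) := by abel
        rw [this]
        exact KZ.relations.neg_mem hxe
  intro hc0
  obtain ⟨e, he, hce⟩ := key
  have h1 : KZ.eval (c - e) = 0 := AddMonoidHom.mem_ker.1 (KZ.relations_le_ker_eval_holds hce)
  have he0 : KZ.eval e = 0 := by
    rw [map_sub, hc0, zero_sub, neg_eq_zero] at h1
    exact h1
  have hemem : e ∈ KZ.relations := hT e he he0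
  have : c = (c - e) + e := by abel
  rw [this]
  exact KZ.relations.add_mem hce hemem

/-- **`BiellipticRealPeriodCell` holds** (crux stmt-KontsevichZagierPeriods-18685 of route
IsogenyCertificates, concluded by name): the generatorwise transfer of the bielliptic sector into the
real-period cell (i) (`Assembly.stub_assembly_of_halfMovesSa` applied to the two rule-(2) moves
`HalfMoves.stub_halfMoves`), the kernel transfer `kernel_transfer`, and the landed cell
`XMapKernelCells.realPeriodCellKernel_relations`. Unconditional. [cite: KontsevichZagier2001, §1.2] -/
theorem BiellipticRealPeriodCell_proof : BiellipticRealPeriodCell :=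
  kernel_transfer
    (BiellipticRealPeriodCellStubs.Assembly.stub_assembly_of_halfMovesSa
      BiellipticRealPeriodCellStubs.HalfMoves.stub_halfMoves)
    XMapKernelCells.realPeriodCellKernel_relations

end Summit.KontsevichZagierPeriods.IsogenyCertificates.BiellipticRealPeriodCellLine

end
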